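import Mathlib
import Summits.Ventures.PercRepro2.ExplorationCanonical
import Summits.Ventures.PercRepro2.ExplorationTreeFresh
import Summits.Ventures.PercRepro2.A3BetweenCondExp

/-!
# The exhaustive exploration of a cluster: `σ(C(a₃))` is coarser than the leaf σ-algebra of the
exploration that reveals it (blind cell PercRepro2, typer-1 g20; a language line)

`ExplorationCanonical.lean` explores the cluster of `a₃` edge by edge and STOPS when `a₂` or `a₁`
joins it.  `clusterTree` is the same rule with no stop but exhaustion: reveal the first unexplored
edge (in a fixed enumeration `es`) touching the explored cluster, until none is left.  Every leaf
is exhausted, so on a leaf's event the cluster of `a₃` IS the explored cluster of the leaf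
(`clusterMap_eq_of_mem_event`): the cluster map factors through the leaf map
(`clusterMap_eq_comp_leafOf`), hence

* **`clusterSigma_le_leafSigma_clusterTree`**: `σ(C(a₃)) ≤ leafSigma (clusterTree …)`;
* **`prob_clusterEvent_eq_sum_leaves`**: the law of the cluster is an exploration sum,
  `P_p(C(a₃) = W) = Σ_{ℓ ∈ leaves, exploredCluster ℓ = W} P_p(ℓ)` (any commutative ring);
* **`condExp_clusterSigma_eq_condExp_leafMean`** (the tower): conditioning on the revealed
  cluster is conditioning on the exploration that reveals it and then averaging out the internal
  edges, `μ_p[f | σ(C(a₃))] =ᵐ μ_p[leafMean p (clusterTree …) f | σ(C(a₃))]`;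
* the frozen form **`condExp_clusterSigma_eq_condExp_expect_freeze`**.

Identities only; no sign is claimed; the crux and the residual are as they are.
-/

namespace Summit.Ventures.PercRepro2

open MeasureTheory ProbabilityTheory MeasureBridge

namespace ExplorationTree

namespace Canonical

open Classical

section Defs

variable {V : Type*} {E : Type*} [Fintype V] [Fintype E] [DecidableEq E]

/-- The exhaustive exploration of the cluster of `a₃`: reveal the first unexplored edge of `es`
touching the explored cluster; stop only when none is left. -/
noncomputable def clusterTree (ends : E → Sym2 V) (a₃ : V) (es : List E) (F : Finset E)
    (σ : Config E) : ETree E :=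
  match _hne : nextEdge ends a₃ es F σ with
  | none => .leaf
  | some e =>
    .node e (clusterTree ends a₃ es (insert e F) (Function.update σ e false))
      (clusterTree ends a₃ es (insert e F) (Function.update σ e true))
termination_by (Finset.univ \ F).card
decreasing_by
  all_goals
    have he : e ∉ F := nextEdge_notMem _hne
    rw [Finset.sdiff_insert]
    exact Finset.card_erase_lt_of_mem (Finset.mem_sdiff.2 ⟨Finset.mem_univ e, he⟩)

end Defs

section Lemmas

variable {V : Type*} {E : Type*} [Fintype V] [Fintype E] [DecidableEq E]

/-- The exhaustive cluster exploration is valid from its starting explored set. -/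
theorem valid_clusterTree (ends : E → Sym2 V) (a₃ : V) (es : List E) :
    ∀ n, ∀ (F : Finset E) (σ : Config E), (Finset.univ \ F).card = n →
      Valid (clusterTree ends a₃ es F σ) F := by
  intro n
  induction n using Nat.strong_induction_on with
  | _ n ih =>
  intro F σ hn
  rw [clusterTree]
  split
  · trivial
  · rename_i e he
    have hnot : e ∉ F := nextEdge_notMem he
    have hcard : (Finset.univ \ insert e F).card < n := by
      rw [← hn, Finset.sdiff_insert]
      exact Finset.card_erase_lt_of_mem (Finset.mem_sdiff.2 ⟨Finset.mem_univ e, hnot⟩)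
    exact ⟨hnot, ih _ hcard _ _ rfl, ih _ hcard _ _ rfl⟩

/-- Every leaf of the exhaustive cluster exploration is exhausted. -/
theorem nextEdge_none_of_mem_leaves (ends : E → Sym2 V) (a₃ : V) (es : List E) :
    ∀ n, ∀ (F : Finset E) (σ : Config E), (Finset.univ \ F).card = n →
      ∀ ℓ ∈ leaves (clusterTree ends a₃ es F σ) ⟨F, σ⟩, nextEdge ends a₃ es ℓ.F ℓ.σ = none := by
  intro n
  induction n using Nat.strong_induction_on with
  | _ n ih =>
  intro F σ hn ℓ hℓ
  rw [clusterTree] at hℓ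
  split at hℓ
  · rename_i hnone
    simp only [leaves, List.mem_singleton] at hℓ
    subst hℓ
    exact hnone
  · rename_i e he
    have hnot : e ∉ F := nextEdge_notMem he
    have hcard : (Finset.univ \ insert e F).card < n := by
      rw [← hn, Finset.sdiff_insert]
      exact Finset.card_erase_lt_of_mem (Finset.mem_sdiff.2 ⟨Finset.mem_univ e, hnot⟩)
    simp only [leaves, List.mem_append] at hℓ
    rcases hℓ with hℓ | hℓ
    · exact ih _ hcard _ _ rfl ℓ hℓ
    · exact ih _ hcard _ _ rfl ℓ hℓ

/-- On the event of an exhausted partial configuration the cluster of `a₃` is the explored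
cluster (as sets). -/
lemma cluster_eq_exploredCluster_of_none {ends : E → Sym2 V} {a₃ : V} {es : List E}
    (hes : ∀ e, e ∈ es) {F : Finset E} {σ ω : Config E} (hω : ω ∈ cylinder F σ)
    (h : nextEdge ends a₃ es F σ = none) :
    cluster ends ω a₃ = (↑(exploredCluster ends a₃ F σ) : Set V) := by
  ext v
  rw [Finset.mem_coe, mem_cluster]
  exact ⟨fun hv => cluster_subset_exploredCluster_of_none hes hω h hv,
    fun hv => exploredCluster_subset_cluster hω hv⟩

end Lemmas

/-! ## The cluster map factors through the leaf map -/

section Cluster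

variable {V : Type*} {E : Type*} [Fintype V] [DecidableEq V] [Fintype E] [DecidableEq E]

/-- On the event of a leaf of the exhaustive cluster exploration from the root, the revealed
cluster `C(a₃)` is the explored cluster of the leaf. -/
theorem clusterMap_eq_of_mem_event (ends : E → Sym2 V) (a₃ : V) (es : List E)
    (hes : ∀ e, e ∈ es) {ℓ : Partial E}
    (hℓ : ℓ ∈ leaves (clusterTree ends a₃ es ∅ (fun _ => false)) root) {ω : Config E}
    (hω : ω ∈ ℓ.event) :
    CovForm.A3Means.clusterMap ends a₃ ω = exploredCluster ends a₃ ℓ.F ℓ.σ := by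
  have hnone : nextEdge ends a₃ es ℓ.F ℓ.σ = none :=
    nextEdge_none_of_mem_leaves ends a₃ es _ ∅ (fun _ => false) rfl ℓ hℓ
  apply Finset.coe_injective
  rw [CovForm.A3Means.clusterMap, CovForm.A3Fibre.coe_clusterFinset]
  exact cluster_eq_exploredCluster_of_none hes hω hnone

/-- The cluster map factors through the leaf map of the exhaustive cluster exploration. -/
theorem clusterMap_eq_comp_leafOf (ends : E → Sym2 V) (a₃ : V) (es : List E)
    (hes : ∀ e, e ∈ es) :
    CovForm.A3Means.clusterMap ends a₃ =
      (fun ℓ : Partial E => exploredCluster ends a₃ ℓ.F ℓ.σ) ∘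
        leafOf (clusterTree ends a₃ es ∅ (fun _ => false)) root := by
  funext ω
  simp only [Function.comp_apply]
  have hv : Valid (clusterTree ends a₃ es ∅ (fun _ => false)) ∅ :=
    valid_clusterTree ends a₃ es _ ∅ (fun _ => false) rfl
  exact clusterMap_eq_of_mem_event ends a₃ es hes (leafOf_mem_leaves _ root ω)
    (mem_event_leafOf _ root hv ω (by rw [root_event]; trivial))

/-- **The σ-algebra of the revealed cluster is coarser than the leaf σ-algebra of the exploration
that reveals it**: `σ(C(a₃)) ≤ leafSigma (clusterTree …)`. -/
theorem clusterSigma_le_leafSigma_clusterTree (ends : E → Sym2 V) (a₃ : V) (es : List E)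
    (hes : ∀ e, e ∈ es) :
    CovForm.A3Means.clusterSigma ends a₃ ≤
      leafSigma (clusterTree ends a₃ es ∅ (fun _ => false)) := by
  rw [CovForm.A3Means.clusterSigma, clusterMap_eq_comp_leafOf ends a₃ es hes,
    ← MeasurableSpace.comap_comp]
  exact MeasurableSpace.comap_mono le_top

/-- **The law of the revealed cluster is an exploration sum**:
`P_p(C(a₃) = W) = Σ_{ℓ ∈ leaves, exploredCluster ℓ = W} P_p(ℓ)` (any commutative ring). -/
theorem prob_clusterEvent_eq_sum_leaves {R : Type*} [CommRing R] (p : E → R) (ends : E → Sym2 V)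
    (a₃ : V) (es : List E) (hes : ∀ e, e ∈ es) (W : Finset V) :
    prob p (clusterEvent ends a₃ (↑W : Set V)) =
      (((leaves (clusterTree ends a₃ es ∅ (fun _ => false)) root).filter
        fun ℓ => exploredCluster ends a₃ ℓ.F ℓ.σ = W).map fun ℓ => prob p ℓ.event).sum := by
  refine prob_eq_sum_leaves_of_determined p _ (valid_clusterTree ends a₃ es _ ∅ (fun _ => false) rfl)
    _ (fun ℓ => exploredCluster ends a₃ ℓ.F ℓ.σ = W) fun ℓ hℓ ω hω => ?_
  rw [CovForm.A3Means.mem_clusterEvent_iff_clusterMap_eq, clusterMap_eq_of_mem_event ends a₃ es hes hℓ hω]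

end Cluster

/-! ## The tower: conditioning on the cluster through the exploration that reveals it -/

section Tower

variable {V : Type*} {E : Type*} [Fintype V] [DecidableEq V] [Fintype E] [DecidableEq E]

/-- **Conditioning on the revealed cluster is conditioning on the exploration that reveals it and
then averaging out the internal edges**:
`μ_p[f | σ(C(a₃))] =ᵐ μ_p[leafMean p (clusterTree …) f | σ(C(a₃))]`. -/
theorem condExp_clusterSigma_eq_condExp_leafMean (p : E → ℝ) (hp : IsProbVec p)
    (ends : E → Sym2 V) (a₃ : V) (es : List E) (hes : ∀ e, e ∈ es) (f : Config E → ℝ) :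
    (percMeasureOf p hp)[f | CovForm.A3Means.clusterSigma ends a₃] =ᵐ[percMeasureOf p hp]
      (percMeasureOf p hp)[leafMean p (clusterTree ends a₃ es ∅ (fun _ => false)) f |
        CovForm.A3Means.clusterSigma ends a₃] := by
  have hle := clusterSigma_le_leafSigma_clusterTree ends a₃ es hes
  have hv : Valid (clusterTree ends a₃ es ∅ (fun _ => false)) ∅ :=
    valid_clusterTree ends a₃ es _ ∅ (fun _ => false) rfl
  refine (condExp_condExp_of_le hle (leafSigma_le _)).symm.trans ?_
  exact condExp_congr_ae (condExp_leafSigma p hp _ hv f)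

/-- The frozen form of the tower: `μ_p[g | σ(C(a₃))] =ᵐ μ_p[ω ↦ E_p (g ∘ (leafOf ω).freeze) | σ(C(a₃))]`. -/
theorem condExp_clusterSigma_eq_condExp_expect_freeze (p : E → ℝ) (hp : IsProbVec p)
    (ends : E → Sym2 V) (a₃ : V) (es : List E) (hes : ∀ e, e ∈ es) (g : Config E → ℝ) :
    (percMeasureOf p hp)[g | CovForm.A3Means.clusterSigma ends a₃] =ᵐ[percMeasureOf p hp]
      (percMeasureOf p hp)[fun ω =>
        expect p (g ∘ (leafOf (clusterTree ends a₃ es ∅ (fun _ => false)) root ω).freeze) |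
        CovForm.A3Means.clusterSigma ends a₃] := by
  have h := condExp_clusterSigma_eq_condExp_leafMean p hp ends a₃ es hes g
  rwa [leafMean_eq_expect_freeze] at h

end Tower

end Canonical

end ExplorationTree

end Summit.Ventures.PercRepro2
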